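import Literature.NumberTheory.Automorphic.IrreducibleClassesConstituentsIsotypic
import Literature.NumberTheory.Automorphic.JacquetModuleExactProofs
import Literature.NumberTheory.Automorphic.JacquetModuleFrobeniusProofs
import Literature.NumberTheory.Automorphic.CompactRepProjective
import HarnessLib

/-!
# Crux `H413`, pay-down of the K1w letter — file 1/4: generic Jacquet-module ∕ constituent lemmas

Cell hodgecm-mathlib (D-0151), FLOOR 0, crux item H413 = stmt-HodgeConjecture-24833, pay-down line
`Cruxes/H413/Lines/F0_P2GR91NJacquet.lean`, K1 sub-line `Lines/F0_P2GR91NJacquetK1.lean` (edition v3a, 368644d96141), whose K1w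
branch is closed BY NAME over the printed letter ★ `Rogawski1990.cmPrincipalSeries_isConstituentOf_weylConj` («`i_G(χ)` and `i_G(wχ)`
have the same constituents», [Rogawski1990, §12.2 p. 174]; [BernsteinZelevinsky1977, Thm. 2.9]).  This file and its three sequels PAY
that letter in house from the two already-booked letters N1 (★ `UnitaryGroup.U3PrincipalSeriesJacquetFiltration`, [Casselman1995,
L. 7.1.1 (a)]) and N6 (★ `Rogawski1990.u3_isSupercuspidal_iff_jacquet_eq_zero`, [Casselman1995, Thm. 5.3.1]) by Casselman's rank-one
bookkeeping ([Casselman1995, §7.1]) — no characters, no intertwining integrals.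
HC_CM is proved only modulo the 2 remaining named inputs (hLiu418, h413) until rung 0 closes; nothing here proves HC_CM.

THIS FILE (generic: any group `G` with a parabolic triple `t = (P, M, N)`; theorems only, no definition, no named fact):
* §1 `subsingleton_coinvariants_of_isConstituentOf` — a constituent of a SMOOTH representation with ZERO Jacquet module has
  zero Jacquet module (exactness of `r_P`: ★ `jacquetMap_injective` needs `IsLimitOfCompactOpen t.N`, ★ `jacquetMap_surjective`);
* §2 the EVALUATION-AT-ONE functional of `i_P^G(χ) = normalizedInd t (trivial ⊗ χ)`: it descends to the Jacquet module
  (`exists_evalOne_coinvariants`), is `(M, χ)`-equivariant for the NORMALISED Jacquet action, and does not vanish on the image of any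
  non-zero subrepresentation (`evalOne_ne_zero_of_ne_bot`); hence a non-zero intertwining map `π → i(χ)` forces `r_P π ≠ 0`
  (`nontrivial_coinvariants_of_intertwiningMap_ne_zero`) [BernsteinZelevinsky1977, Prop. 1.9 (b)–(c)];
* §3 `exists_injective_of_isConstituentOf_of_isSupercuspidal` — a SUPERCUSPIDAL (compact-mod-centre coefficients) admissible
  constituent of a smooth representation is realised as a SUBrepresentation (★ `Representation.exists_section_of_isSupercuspidal`:
  compact irreducibles are projective, [BernsteinZelevinsky1976, Thm. 2.44]; [Casselman1995, Thm. 5.4.1]);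
* §4 `not_isConstituentOf_normalizedInd_of_subsingleton_coinvariants` — so a supercuspidal class with zero Jacquet module is
  NOT a constituent of any `i_P^G(χ)` ([Casselman1995, Cor. 5.4.3 ∕ Thm. 6.3.5]; [BernsteinZelevinsky1977, Thm. 2.5]);
* §5 Frobenius reciprocity packaged (★ `frobeniusEquiv` ∘ ★ `normalizedJacquetHomEquiv`): a non-zero `M`-map `r_P π → ℂ_χ` gives a
  non-zero `G`-map `π → i(χ)` (`exists_intertwiningMap_normalizedInd_ne_zero`), and if `Hom_M(r_P π, ℂ_χ)` is a line so is `Hom_G(π, i(χ))`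
  (`intertwiningMap_normalizedInd_eq_smul`); the identity of `i(χ)` is non-zero once `r_P i(χ) ≠ 0` (`id_normalizedInd_ne_zero`).

## References
* [Casselman1995] W. Casselman, *Introduction to the theory of admissible representations of `p`-adic reductive groups* (1995):
  Prop. 3.2.3, Thm. 3.2.4, Thm. 5.4.1, Cor. 5.4.3, Thm. 6.3.5, §7.1.
* [BernsteinZelevinsky1977] I. N. Bernstein, A. V. Zelevinsky, Ann. Sci. ÉNS 10 (1977): Prop. 1.9, Thm. 2.4, Thm. 2.5, Thm. 2.9.
* [BernsteinZelevinsky1976] Russian Math. Surveys 31 (1976): Prop. 2.35, Thm. 2.44.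
* [Rogawski1990] J. Rogawski, Ann. of Math. Stud. 123 (1990): §12.2 p. 173–174.
-/

set_option autoImplicit false
-- the mandated namespace has the single-problem summit's repeated segment (`HodgeConjecture.HodgeConjecture`)
set_option linter.dupNamespace false

noncomputable section

open Literature.NumberTheory.Automorphic Literature.RepresentationTheory.FiniteGroups
open Literature.RepresentationTheory.Semisimple

namespace Summit.HodgeConjecture.HodgeConjecture.Cruxes.H413.F0P2pJacquetConstituentLemmas

universe u

/-! ## §1 Constituents of a representation with zero Jacquet module -/

section ZeroJacquet

variable {G : Type u} [Group G] [TopologicalSpace G] [IsTopologicalGroup G] (t : ParabolicTriple G)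

omit [TopologicalSpace G] [IsTopologicalGroup G] in
/-- Transport of «zero Jacquet module» along an equivalence of representations (the Jacquet map of the inverse equivalence is onto).
[folklore] -/
theorem subsingleton_coinvariants_of_equiv {V W : Type*} [AddCommGroup V] [Module ℂ V] [AddCommGroup W] [Module ℂ W]
    {ρ : Representation ℂ G V} {σ : Representation ℂ G W} (e : ρ.Equiv σ)
    (h : Subsingleton (t.restrict ρ).Coinvariants) : Subsingleton (t.restrict σ).Coinvariants :=
  (Representation.jacquetMap_surjective t e.toIntertwiningMap e.toLinearEquiv.surjective).subsingleton

/-- **A constituent of a smooth representation with ZERO Jacquet module has zero Jacquet module** (w.r.t. the same parabolic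
triple `t = (P, M, N)`, `N` a limit of compact open subgroups): if `Q` is smooth with `(Q)_N = 0` and `⟦r⟧ ≅ N₁ ⁄ N₂` is a constituent
of `Q`, then `(r)_N = 0` — `(N₁)_N ↪ (Q)_N` by left exactness (★ `jacquetMap_injective`), `(N₁)_N ↠ (N₁ ⁄ N₂)_N` by right exactness,
and `(r)_N ≅ (N₁ ⁄ N₂)_N`. [cite: BernsteinZelevinsky1977, Prop. 1.9 (a)] [cite: Casselman1995, Prop. 3.2.3] -/
theorem subsingleton_coinvariants_of_isConstituentOf {W : Type*} [AddCommGroup W] [Module ℂ W]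
    {Q : Representation ℂ G W} (hQ : Q.IsSmooth) (hN : IsLimitOfCompactOpen t.N)
    (hQN : Subsingleton (t.restrict Q).Coinvariants) (r : SmoothIrrep G) (hr : (IrrClass.mk r).IsConstituentOf Q) :
    Subsingleton (t.restrict r.ρ).Coinvariants := by
  obtain ⟨r', hr', N₁, N₂, hle, ⟨φ⟩⟩ := hr
  let N₂' : Subrepresentation N₁.toRepresentation :=
    ⟨N₂.toSubmodule.comap N₁.toSubmodule.subtype, fun g _ hx ↦ N₂.apply_mem_toSubmodule g hx⟩
  have φ' : r'.ρ.Equiv N₂'.quotientRep := φ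
  -- `(N₁)_N ↪ (Q)_N = 0`
  have h1 : Subsingleton (t.restrict N₁.toRepresentation).Coinvariants :=
    (Representation.jacquetMap_injective t hN hQ (Subrepresentation.subtypeIntertwiningMap N₁)
      (Subrepresentation.subtypeIntertwiningMap_injective N₁)).subsingleton
  -- `(N₁)_N ↠ (N₁ ⁄ N₂)_N`
  have h2 : Subsingleton (t.restrict N₂'.quotientRep).Coinvariants :=
    (Representation.jacquetMap_surjective t N₂'.mkQ N₂'.mkQ_surjective).subsingleton
  -- transport to `r'` and then to `r`
  have h3 : Subsingleton (t.restrict r'.ρ).Coinvariants := subsingleton_coinvariants_of_equiv t φ'.symm h2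
  obtain ⟨e⟩ := (IrrClass.mk_eq_mk_iff r' r).1 hr'
  exact subsingleton_coinvariants_of_equiv t e h3

end ZeroJacquet

/-! ## §2 The evaluation-at-one functional on the Jacquet module of `i_P^G(χ)` -/

section EvalOne

variable {G : Type u} [Group G] [TopologicalSpace G] [IsTopologicalGroup G] (t : ParabolicTriple G) [LocallyCompactSpace t.P]

/-- The inducing datum of `i_P^G(χ) = normalizedInd t (trivial ⊗ χ)` acts on `ℂ` by the scalar `δ_P^{1/2}(p) · χ(proj p)`.
[cite: BernsteinZelevinsky1977, §2.3] -/
theorem twist_trivial_twist_comp_proj_apply (χ : ↥t.M →* ℂˣ) (p : ↥t.P) (z : ℂ) :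
    Representation.twist (((Representation.trivial ℂ ↥t.M ℂ).twist χ).comp t.proj) (rootDeltaChar t.P) p z =
      (((rootDeltaChar t.P p : ℂˣ) : ℂ) * ((χ (t.proj p) : ℂˣ) : ℂ)) * z := by
  simp only [Representation.twist_apply, MonoidHom.coe_comp, Function.comp_apply, Representation.trivial,
    MonoidHom.one_apply, Module.End.one_apply, smul_eq_mul]
  ring

/-- On `N` the inducing datum of `i_P^G(χ)` is TRIVIAL when `δ_P|_N = 1` (and `proj n = 1`). [cite: BernsteinZelevinsky1977, §1.8] -/
theorem twist_trivial_twist_comp_proj_apply_of_mem_N (χ : ↥t.M →* ℂˣ)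
    (hδ : ∀ (n : G) (hn : n ∈ t.N), deltaChar t.P ⟨n, t.N_le hn⟩ = 1) (n : G) (hn : n ∈ t.N) (z : ℂ) :
    Representation.twist (((Representation.trivial ℂ ↥t.M ℂ).twist χ).comp t.proj) (rootDeltaChar t.P) ⟨n, t.N_le hn⟩ z = z := by
  rw [twist_trivial_twist_comp_proj_apply, rootDeltaChar_eq_one_of_deltaChar_eq_one _ (hδ n hn),
    t.proj_apply_of_mem_N ⟨n, t.N_le hn⟩ hn, map_one, Units.val_one, one_mul, one_mul]

/-- **The evaluation-at-one functional descends to the Jacquet module of `i_P^G(χ)`** (`δ_P|_N = 1`): there is a linear form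
`ℓ : (i(χ))_N → ℂ` with `ℓ [f] = f(1)`, and it is `(M, χ)`-EQUIVARIANT for the NORMALISED Jacquet action:
`ℓ (r_P(m) x) = χ(m) · ℓ x` (the factor `δ_P^{-1/2}(m)` of `r_P` cancels the `δ_P^{1/2}(m)` of the inducing datum).  This is the unit of
Frobenius reciprocity [BernsteinZelevinsky1977, Prop. 1.9 (b)]. [cite: BernsteinZelevinsky1977, Prop. 1.9 (b)] [cite: Casselman1995, Thm. 3.2.4] -/
theorem exists_evalOne_coinvariants (χ : ↥t.M →* ℂˣ)
    (hδ : ∀ (n : G) (hn : n ∈ t.N), deltaChar t.P ⟨n, t.N_le hn⟩ = 1) :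
    ∃ ℓ : (t.restrict (Representation.normalizedInd t ((Representation.trivial ℂ ↥t.M ℂ).twist χ))).Coinvariants →ₗ[ℂ] ℂ,
      (∀ f, ℓ (Representation.Coinvariants.mk _ f) = f.toFun 1) ∧
      (∀ (m : ↥t.M) x, ℓ ((Representation.normalizedInd t ((Representation.trivial ℂ ↥t.M ℂ).twist χ)).normalizedJacquet t m x) =
        ((χ m : ℂˣ) : ℂ) * ℓ x) := by
  -- the linear form `f ↦ f(1)` on `i(χ)`
  let ev : Representation.SmoothInd t.P
      (Representation.twist (((Representation.trivial ℂ ↥t.M ℂ).twist χ).comp t.proj) (rootDeltaChar t.P)) →ₗ[ℂ] ℂ :=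
    { toFun := fun f => f.toFun 1
      map_add' := fun f g => by simp
      map_smul' := fun c f => by simp }
  -- it is `N`-invariant
  have hev : ∀ n : ↥(t.N.subgroupOf t.P),
      ev ∘ₗ (t.restrict (Representation.normalizedInd t ((Representation.trivial ℂ ↥t.M ℂ).twist χ))) n = ev := by
    intro n
    apply LinearMap.ext
    intro f
    have hn : ((n : ↥t.P) : G) ∈ t.N := Subgroup.mem_subgroupOf.1 n.2
    change ((Representation.normalizedInd t ((Representation.trivial ℂ ↥t.M ℂ).twist χ)) ((n : ↥t.P) : G) f).toFun 1 = f.toFun 1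
    rw [Representation.normalizedInd, Representation.toFun_smoothIndRep_apply, one_mul,
      ← mul_one (((n : ↥t.P) : G)), show ((n : ↥t.P) : G) * 1 = ((⟨(n : ↥t.P), hn |> fun h => t.N_le h⟩ : ↥t.P) : G) * 1 from rfl,
      Representation.SmoothInd.toFun_subgroup_mul, twist_trivial_twist_comp_proj_apply_of_mem_N t χ hδ _ hn]
  refine ⟨Representation.Coinvariants.lift _ ev hev, fun f => rfl, fun m x => ?_⟩
  obtain ⟨f, rfl⟩ := Representation.Coinvariants.mk_surjective _ x
  rw [Representation.normalizedJacquet_mk, map_smul, Representation.Coinvariants.lift_mk, Representation.Coinvariants.lift_mk,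
    smul_eq_mul]
  change (((rootDeltaChar t.P (Subgroup.inclusion t.M_le m))⁻¹ : ℂˣ) : ℂ) *
      ((Representation.normalizedInd t ((Representation.trivial ℂ ↥t.M ℂ).twist χ)) ((m : ↥t.M) : G) f).toFun 1 = _
  rw [Representation.normalizedInd, Representation.toFun_smoothIndRep_apply, one_mul,
    ← mul_one ((m : ↥t.M) : G), show ((m : ↥t.M) : G) * 1 = ((Subgroup.inclusion t.M_le m : ↥t.P) : G) * 1 from rfl,
    Representation.SmoothInd.toFun_subgroup_mul, twist_trivial_twist_comp_proj_apply, t.proj_inclusion]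
  change _ * (_ * ev f) = _ * ev f
  rw [← mul_assoc, ← mul_assoc, Units.inv_mul, one_mul]

/-- **`f ↦ f(1)` does not vanish on (the image in the Jacquet module of) any NON-ZERO subrepresentation `F ≤ i_P^G(χ)`**: some
`f ∈ F` has `f(g) ≠ 0`, and then `(g · f)(1) = f(g) ≠ 0` with `g · f ∈ F`. [cite: BernsteinZelevinsky1977, Prop. 1.9 (c)] -/
theorem exists_mem_toFun_one_ne_zero_of_ne_bot (χ : ↥t.M →* ℂˣ)
    (F : Subrepresentation (Representation.normalizedInd t ((Representation.trivial ℂ ↥t.M ℂ).twist χ))) (hF : F ≠ ⊥) :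
    ∃ f ∈ F, (f : Representation.SmoothInd t.P
      (Representation.twist (((Representation.trivial ℂ ↥t.M ℂ).twist χ).comp t.proj) (rootDeltaChar t.P))).toFun 1 ≠ 0 := by
  obtain ⟨f₀, hf₀F, hf₀⟩ := (Submodule.ne_bot_iff F.toSubmodule).1 fun h => hF (Subrepresentation.toSubmodule_injective h)
  have hne : f₀.toFun ≠ 0 := fun h => hf₀ (Representation.SmoothInd.ext (by rw [h]; rfl))
  obtain ⟨g, hg⟩ := Function.ne_iff.1 hne
  refine ⟨(Representation.normalizedInd t ((Representation.trivial ℂ ↥t.M ℂ).twist χ)) g f₀, F.apply_mem_toSubmodule g hf₀F, ?_⟩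
  rw [Representation.normalizedInd, Representation.toFun_smoothIndRep_apply, one_mul]
  exact hg

/-- **A non-zero intertwining map into `i_P^G(χ)` forces a non-zero Jacquet module** (`δ_P|_N = 1`): if `f : π → i(χ)` is a
`G`-map with `f ≠ 0` then `(π)_N` is non-trivial — evaluate at one after translating (the easy half of Frobenius reciprocity).
[cite: BernsteinZelevinsky1977, Prop. 1.9 (b)] [cite: Casselman1995, Thm. 3.2.4] -/
theorem nontrivial_coinvariants_of_intertwiningMap_ne_zero (χ : ↥t.M →* ℂˣ)
    (hδ : ∀ (n : G) (hn : n ∈ t.N), deltaChar t.P ⟨n, t.N_le hn⟩ = 1)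
    {V : Type*} [AddCommGroup V] [Module ℂ V] {π : Representation ℂ G V}
    (f : π.IntertwiningMap (Representation.normalizedInd t ((Representation.trivial ℂ ↥t.M ℂ).twist χ))) (hf : f ≠ 0) :
    Nontrivial (t.restrict π).Coinvariants := by
  obtain ⟨ℓ, hℓ, -⟩ := exists_evalOne_coinvariants t χ hδ
  have hR : f.range ≠ ⊥ := by
    intro h
    apply hf
    apply Representation.IntertwiningMap.ext
    apply LinearMap.ext
    intro v
    have hv : f v ∈ f.range := ⟨v, rfl⟩
    rw [h] at hv
    exact (Submodule.mem_bot ℂ).1 hv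
  obtain ⟨w, ⟨v, rfl⟩, hw⟩ := exists_mem_toFun_one_ne_zero_of_ne_bot t χ f.range hR
  refine ⟨⟨Representation.Coinvariants.mk _ v, 0, fun h0 => hw ?_⟩⟩
  have h1 : ℓ (Representation.jacquetMap t f (Representation.Coinvariants.mk _ v)) = 0 := by rw [h0, map_zero, map_zero]
  rw [Representation.jacquetMap_mk, hℓ] at h1
  exact h1

end EvalOne

/-! ## §3 Supercuspidal constituents are subrepresentations (projectivity) -/

section Projective

variable {G : Type u} [Group G] [TopologicalSpace G] [IsTopologicalGroup G]

/-- **A supercuspidal admissible constituent of a smooth representation OCCURS AS A SUBREPRESENTATION**: if `⟦r⟧ ≅ N₁ ⁄ N₂` in a smooth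
`ρ`, `r` has compactly supported matrix coefficients (★ `IsSupercuspidal`, centre compact) and is admissible, then the surjection
`N₁ ↠ N₁ ⁄ N₂ ≅ r` splits (★ `Representation.exists_section_of_isSupercuspidal`) and `r ↪ N₁ ≤ ρ`.
[cite: BernsteinZelevinsky1976, Thm. 2.44] [cite: Casselman1995, Thm. 5.4.1] -/
theorem exists_injective_of_isConstituentOf_of_isSupercuspidal {K₀ : Subgroup G} (hK₀o : IsOpen (K₀ : Set G))
    (hK₀c : IsCompact (K₀ : Set G)) (hZ : IsCompact (Subgroup.center G : Set G))
    {V : Type*} [AddCommGroup V] [Module ℂ V] {ρ : Representation ℂ G V} (hρ : ρ.IsSmooth)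
    (r : SmoothIrrep G) (hsc : r.ρ.IsSupercuspidal) (hadm : r.ρ.IsAdmissible) (hr : (IrrClass.mk r).IsConstituentOf ρ) :
    ∃ f : r.ρ.IntertwiningMap ρ, Function.Injective f := by
  obtain ⟨r', hr', N₁, N₂, hle, ⟨φ⟩⟩ := hr
  obtain ⟨e⟩ := (IrrClass.mk_eq_mk_iff r' r).1 hr'
  let N₂' : Subrepresentation N₁.toRepresentation :=
    ⟨N₂.toSubmodule.comap N₁.toSubmodule.subtype, fun g _ hx ↦ N₂.apply_mem_toSubmodule g hx⟩
  have φ' : r'.ρ.Equiv N₂'.quotientRep := φ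
  -- the surjection `N₁ ↠ N₁ ⁄ N₂ ≅ r' ≅ r`
  let ψ : r.ρ.Equiv N₂'.quotientRep := e.symm.trans φ'
  let q : N₁.toRepresentation.IntertwiningMap r.ρ := ψ.symm.toIntertwiningMap.comp N₂'.mkQ
  have hq : Function.Surjective q := fun x => by
    obtain ⟨y, hy⟩ := N₂'.mkQ_surjective (ψ x)
    exact ⟨y, by simp [q, hy]⟩
  obtain ⟨s, hs⟩ := Representation.exists_section_of_isSupercuspidal hK₀o hK₀c hsc hZ hadm (hρ.toRepresentation N₁) q hq
  refine ⟨(Subrepresentation.subtypeIntertwiningMap N₁).comp s, ?_⟩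
  exact (Subrepresentation.subtypeIntertwiningMap_injective N₁).comp (Function.LeftInverse.injective hs)

end Projective

/-! ## §4 No supercuspidal-with-zero-Jacquet-module constituent in `i_P^G(χ)` -/

section NoCuspidal

variable {G : Type u} [Group G] [TopologicalSpace G] [IsTopologicalGroup G] (t : ParabolicTriple G) [LocallyCompactSpace t.P]

/-- **A supercuspidal admissible class with ZERO Jacquet module is not a constituent of `i_P^G(χ)`** (`δ_P|_N = 1`, centre compact, a
compact open subgroup): it would occur as a subrepresentation (§3), hence have a non-zero Jacquet module (§2).
[cite: Casselman1995, Thm. 6.3.5] [cite: BernsteinZelevinsky1977, Thm. 2.5] -/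
theorem not_isConstituentOf_normalizedInd_of_subsingleton_coinvariants {K₀ : Subgroup G} (hK₀o : IsOpen (K₀ : Set G))
    (hK₀c : IsCompact (K₀ : Set G)) (hZ : IsCompact (Subgroup.center G : Set G)) (χ : ↥t.M →* ℂˣ)
    (hδ : ∀ (n : G) (hn : n ∈ t.N), deltaChar t.P ⟨n, t.N_le hn⟩ = 1)
    (r : SmoothIrrep G) (hsc : r.ρ.IsSupercuspidal) (hadm : r.ρ.IsAdmissible)
    (h0 : Subsingleton (t.restrict r.ρ).Coinvariants) :
    ¬ (IrrClass.mk r).IsConstituentOf (Representation.normalizedInd t ((Representation.trivial ℂ ↥t.M ℂ).twist χ)) := by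
  intro hr
  obtain ⟨f, hf⟩ := exists_injective_of_isConstituentOf_of_isSupercuspidal hK₀o hK₀c hZ
    (Representation.isSmooth_smoothInd t.P _) r hsc hadm hr
  haveI : Nontrivial r.V := IrrClass.nontrivial_of_isIrreducible r.ρ
  have hf0 : f ≠ 0 := by
    obtain ⟨v, hv⟩ := exists_ne (0 : r.V)
    intro h
    exact hv (hf (by rw [h, map_zero]; rfl))
  haveI := nontrivial_coinvariants_of_intertwiningMap_ne_zero t χ hδ f hf0
  exact false_of_nontrivial_of_subsingleton (t.restrict r.ρ).Coinvariants

end NoCuspidal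

/-! ## §5 Frobenius reciprocity, packaged: existence and uniqueness of `G`-maps into `i_P^G(χ)` -/

section Frobenius

variable {G : Type u} [Group G] [TopologicalSpace G] [IsTopologicalGroup G] (t : ParabolicTriple G) [LocallyCompactSpace t.P]

/-- **Frobenius reciprocity, existence form**: a non-zero `M`-map `r_P π → ℂ_χ` gives a non-zero `G`-map `π → i_P^G(χ)` (★ `frobeniusEquiv`
composed with ★ `normalizedJacquetHomEquiv`; `δ_P|_N = 1`). [cite: BernsteinZelevinsky1977, Prop. 1.9 (b)] [cite: Casselman1995, Thm. 3.2.4] -/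
theorem exists_intertwiningMap_normalizedInd_ne_zero
    (hδ : ∀ (n : G) (hn : n ∈ t.N), deltaChar t.P ⟨n, t.N_le hn⟩ = 1)
    {V : Type*} [AddCommGroup V] [Module ℂ V] (π : Representation ℂ G V) (hπ : π.IsSmooth) (χ : ↥t.M →* ℂˣ)
    (φ : (π.normalizedJacquet t).IntertwiningMap ((Representation.trivial ℂ ↥t.M ℂ).twist χ)) (hφ : φ ≠ 0) :
    ∃ B : π.IntertwiningMap (Representation.normalizedInd t ((Representation.trivial ℂ ↥t.M ℂ).twist χ)), B ≠ 0 := by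
  let E : π.IntertwiningMap (Representation.normalizedInd t ((Representation.trivial ℂ ↥t.M ℂ).twist χ)) ≃ₗ[ℂ]
      (π.normalizedJacquet t).IntertwiningMap ((Representation.trivial ℂ ↥t.M ℂ).twist χ) :=
    (Representation.frobeniusEquiv (H := t.P)
      (σ := Representation.twist (((Representation.trivial ℂ ↥t.M ℂ).twist χ).comp t.proj) (rootDeltaChar t.P)) hπ).trans
      (Representation.normalizedJacquetHomEquiv t π ((Representation.trivial ℂ ↥t.M ℂ).twist χ) hδ)
  refine ⟨E.symm φ, fun h => hφ ?_⟩
  rw [← E.apply_symm_apply φ, h, map_zero]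

/-- **Frobenius reciprocity, uniqueness form**: if `Hom_M(r_P π, ℂ_χ)` is a line then so is `Hom_G(π, i_P^G(χ))` — every `G`-map
`π → i(χ)` is a multiple of a given non-zero one. [cite: BernsteinZelevinsky1977, Prop. 1.9 (b)] [cite: Casselman1995, Thm. 3.2.4] -/
theorem intertwiningMap_normalizedInd_eq_smul
    (hδ : ∀ (n : G) (hn : n ∈ t.N), deltaChar t.P ⟨n, t.N_le hn⟩ = 1)
    {V : Type*} [AddCommGroup V] [Module ℂ V] (π : Representation ℂ G V) (hπ : π.IsSmooth) (χ : ↥t.M →* ℂˣ)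
    (huniq : ∀ ψ₁ ψ₂ : (π.normalizedJacquet t).IntertwiningMap ((Representation.trivial ℂ ↥t.M ℂ).twist χ),
      ψ₁ ≠ 0 → ∃ c : ℂ, ψ₂ = c • ψ₁)
    (B₁ B₂ : π.IntertwiningMap (Representation.normalizedInd t ((Representation.trivial ℂ ↥t.M ℂ).twist χ))) (h₁ : B₁ ≠ 0) :
    ∃ c : ℂ, B₂ = c • B₁ := by
  let E : π.IntertwiningMap (Representation.normalizedInd t ((Representation.trivial ℂ ↥t.M ℂ).twist χ)) ≃ₗ[ℂ]
      (π.normalizedJacquet t).IntertwiningMap ((Representation.trivial ℂ ↥t.M ℂ).twist χ) :=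
    (Representation.frobeniusEquiv (H := t.P)
      (σ := Representation.twist (((Representation.trivial ℂ ↥t.M ℂ).twist χ).comp t.proj) (rootDeltaChar t.P)) hπ).trans
      (Representation.normalizedJacquetHomEquiv t π ((Representation.trivial ℂ ↥t.M ℂ).twist χ) hδ)
  have hE₁ : E B₁ ≠ 0 := fun h => h₁ (by rw [← E.symm_apply_apply B₁, h, map_zero])
  obtain ⟨c, hc⟩ := huniq (E B₁) (E B₂) hE₁
  refine ⟨c, E.injective ?_⟩
  rw [hc, map_smul]

/-- `i_P^G(χ)` is a non-trivial space as soon as its Jacquet module is (e.g. two-dimensional), so its identity map is non-zero.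
[cite: Casselman1995, §7.1 L. 7.1.1] -/
theorem id_normalizedInd_ne_zero (χ : ↥t.M →* ℂˣ)
    (hX : Nontrivial (t.restrict (Representation.normalizedInd t ((Representation.trivial ℂ ↥t.M ℂ).twist χ))).Coinvariants) :
    Representation.IntertwiningMap.id (Representation.normalizedInd t ((Representation.trivial ℂ ↥t.M ℂ).twist χ)) ≠ 0 := by
  haveI : Nontrivial (Representation.SmoothInd t.P
      (Representation.twist (((Representation.trivial ℂ ↥t.M ℂ).twist χ).comp t.proj) (rootDeltaChar t.P))) := by
    by_contra h
    rw [not_nontrivial_iff_subsingleton] at h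
    exact not_subsingleton _ ((Representation.Coinvariants.mk_surjective
      (t.restrict (Representation.normalizedInd t ((Representation.trivial ℂ ↥t.M ℂ).twist χ)))).subsingleton)
  obtain ⟨v, hv⟩ := exists_ne (0 : Representation.SmoothInd t.P
      (Representation.twist (((Representation.trivial ℂ ↥t.M ℂ).twist χ).comp t.proj) (rootDeltaChar t.P)))
  intro h
  apply hv
  have := congrArg (fun f : Representation.IntertwiningMap _ _ => f v) h
  simpa using this

end Frobenius

end Summit.HodgeConjecture.HodgeConjecture.Cruxes.H413.F0P2pJacquetConstituentLemmas

end
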